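import Summits.Ventures.PercRepro.Night2FatZThree

/-!
# night-2: at least three points off the spine in each plane (the count)

`two_le_card_side`: the points of `π₃` off the spine number `≥ 2` — a single one would be a coloop of `G` (it is
the only point of `G` outside the hyperplane `clF {k, w₀, s₁, s₂, c₂}`, `sdiff_clF_eq_side`).
`three_le_card_side_of_fat`: under the single fat closure hypothesis they number `≥ 3` — with exactly two, the
five points `k, w₀, s₁, s₂, c₂` form a thin member (`mem_thinMembers_of_rkN_five`: its complement contains the two
points `c₃, m` off the spine, a spine point `s₃` off the line `c₃ m`, the off-point `x` and a second point `a'`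
of `π₂` off the spine, of rank `5`) whose closure is a second fat closure.  Paper `proofs/NIGHT-2-g34.md` §6′ (e).
-/

namespace PercRepro.Shadow

open PercRepro.ThmH PercRepro.PerFlat

variable {α : Type*} [DecidableEq α] {M : Matroid α} [M.Finite] {G : Finset α}

/-- **At least two points of `π₃` off the spine**: a single one would be a coloop of `G`. -/
theorem two_le_card_side (hG : G ∈ flatsQ M (5 + 1)) (hd : (gr M \ G).card = 2)
    (hk : kColoops M G = 1) (hs : ∀ e ∈ gr M, ∀ f ∈ gr M, e ≠ f → rkN M {e, f} = 2)
    {B₀ : Finset α} (hB₀ : B₀ ∈ thinMembers M 5 G) {w₀ x : α} (hD : G \ clF M B₀ = {w₀, x})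
    {R₁ : Finset α} (hR₁V : R₁ ⊆ (G \ coloops M G) \ {w₀, x}) (hR₁2 : rkN M R₁ = 2) (hR₁3 : 3 ≤ R₁.card)
    (hcop : rkN M (insert w₀ (insert x R₁)) ≤ 3) {c₂ c₃ : α}
    (hc₂V : c₂ ∈ (G \ coloops M G) \ {w₀, x}) (hc₃V : c₃ ∈ (G \ coloops M G) \ {w₀, x})
    (hc₂ : c₂ ∉ clF M R₁) (hc₃ : c₃ ∉ clF M (insert c₂ R₁))
    (hcover : ∀ e ∈ (G \ coloops M G) \ {w₀, x}, e ∈ clF M (insert c₂ R₁) ∨ e ∈ clF M (insert c₃ R₁)) :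
    2 ≤ (((G \ coloops M G) \ {w₀, x}).filter
      (fun e => e ∈ clF M (insert c₃ R₁) ∧ e ∉ clF M R₁)).card := by
  have hGg : G ⊆ gr M := (mem_flatsQ.1 hG).1
  obtain ⟨k, hkK⟩ : ∃ k, coloops M G = {k} := by
    rw [kColoops_eq_card_coloops] at hk
    exact Finset.card_eq_one.1 hk
  have hVg : (G \ coloops M G) \ {w₀, x} ⊆ gr M := fun e he =>
    hGg (Finset.mem_sdiff.1 (Finset.mem_sdiff.1 he).1).1
  have hc₃M : c₃ ∈ ((G \ coloops M G) \ {w₀, x}).filter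
      (fun e => e ∈ clF M (insert c₃ R₁) ∧ e ∉ clF M R₁) :=
    Finset.mem_filter.2 ⟨hc₃V, subset_clF_of_subset_gr (Finset.insert_subset (hVg hc₃V) (hR₁V.trans hVg))
      (Finset.mem_insert_self _ _), fun h' => hc₃ (clF_mono (Finset.subset_insert _ _) h')⟩
  obtain ⟨s₁, hs₁, s₂, hs₂, hs12⟩ := Finset.one_lt_card.1 (by omega : 1 < R₁.card)
  by_contra hlt
  have hle1 := Finset.card_le_one.1 (by omega : (((G \ coloops M G) \ {w₀, x}).filter
    (fun e => e ∈ clF M (insert c₃ R₁) ∧ e ∉ clF M R₁)).card ≤ 1)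
  have hside := sdiff_clF_eq_side hG hd hs hB₀ hD hR₁V hR₁2 hcop hc₂V hc₃V hc₂ hc₃ hcover hkK hs₁ hs₂ hs12
  set B' : Finset α := insert k (insert w₀ (insert s₁ (insert s₂ {c₂}))) with hB'
  have hc₃G : c₃ ∈ G := (Finset.mem_sdiff.1 (Finset.mem_sdiff.1 hc₃V).1).1
  have hc₃K : c₃ ∉ coloops M G := (Finset.mem_sdiff.1 (Finset.mem_sdiff.1 hc₃V).1).2
  have hc₃cl : c₃ ∈ clF M (G.erase c₃) := by
    by_contra h'
    exact hc₃K (mem_coloops.2 ⟨hc₃G, h'⟩)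
  have hsub : G.erase c₃ ⊆ clF M B' := by
    intro e he
    by_contra he'
    have : e ∈ G \ clF M B' := Finset.mem_sdiff.2 ⟨(Finset.mem_erase.1 he).2, he'⟩
    rw [hside] at this
    exact (Finset.mem_erase.1 he).1 (hle1 e this c₃ hc₃M)
  have : c₃ ∈ G \ clF M B' := by
    rw [hside]
    exact hc₃M
  exact (Finset.mem_sdiff.1 this).2 (clF_subset_clF_of_subset_clF hsub hc₃cl)

/-- **At least three points of `π₃` off the spine under the single fat closure hypothesis**: with exactly two,
`{k, w₀, s₁, s₂, c₂}` is a thin member whose closure is a second fat closure. -/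
theorem three_le_card_side_of_fat (hG : G ∈ flatsQ M (5 + 1)) (hd : (gr M \ G).card = 2)
    (hk : kColoops M G = 1) (hs : ∀ e ∈ gr M, ∀ f ∈ gr M, e ≠ f → rkN M {e, f} = 2)
    (hfat : (fatClosures M 5 G 2).card ≤ 1)
    {B₀ : Finset α} (hB₀ : B₀ ∈ thinMembers M 5 G) {w₀ x : α} (hD : G \ clF M B₀ = {w₀, x}) (hne : w₀ ≠ x)
    {R₁ : Finset α} (hR₁V : R₁ ⊆ (G \ coloops M G) \ {w₀, x}) (hR₁2 : rkN M R₁ = 2) (hR₁3 : 3 ≤ R₁.card)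
    (hcop : rkN M (insert w₀ (insert x R₁)) ≤ 3) {c₂ c₃ : α}
    (hc₂V : c₂ ∈ (G \ coloops M G) \ {w₀, x}) (hc₃V : c₃ ∈ (G \ coloops M G) \ {w₀, x})
    (hc₂ : c₂ ∉ clF M R₁) (hc₃ : c₃ ∉ clF M (insert c₂ R₁))
    (hcover : ∀ e ∈ (G \ coloops M G) \ {w₀, x}, e ∈ clF M (insert c₂ R₁) ∨ e ∈ clF M (insert c₃ R₁)) :
    3 ≤ (((G \ coloops M G) \ {w₀, x}).filter
      (fun e => e ∈ clF M (insert c₃ R₁) ∧ e ∉ clF M R₁)).card := by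
  have hGg : G ⊆ gr M := (mem_flatsQ.1 hG).1
  have hd' : (gr M \ G).card ≤ 5 := by omega
  have hKB₀ : coloops M G ⊆ B₀ := coloops_subset_of_mem_thinMembers hG hd' hB₀
  have hB₀G : B₀ ⊆ G := subset_G_of_mem_thinMembers hB₀
  have hG6 : rkN M G = 5 + 1 := rkN_eq_of_mem_flatsQ hG
  obtain ⟨k, hkK⟩ : ∃ k, coloops M G = {k} := by
    rw [kColoops_eq_card_coloops] at hk
    exact Finset.card_eq_one.1 hk
  have hkc : k ∈ coloops M G := by rw [hkK]; exact Finset.mem_singleton_self k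
  have hkG : k ∈ G := (mem_coloops.1 hkc).1
  have hkcl : k ∉ clF M (G.erase k) := (mem_coloops.1 hkc).2
  have hVg : (G \ coloops M G) \ {w₀, x} ⊆ gr M := fun e he =>
    hGg (Finset.mem_sdiff.1 (Finset.mem_sdiff.1 he).1).1
  have hVB₀ : (G \ coloops M G) \ {w₀, x} ⊆ clF M B₀ := by
    intro e he
    by_contra he'
    have : e ∈ G \ clF M B₀ :=
      Finset.mem_sdiff.2 ⟨(Finset.mem_sdiff.1 (Finset.mem_sdiff.1 he).1).1, he'⟩
    rw [hD] at this
    exact (Finset.mem_sdiff.1 he).2 this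
  have hVk : (G \ coloops M G) \ {w₀, x} ⊆ G.erase k := fun e he =>
    Finset.mem_erase.2 ⟨fun h' => (Finset.mem_sdiff.1 (Finset.mem_sdiff.1 he).1).2 (h' ▸ hkc),
      (Finset.mem_sdiff.1 (Finset.mem_sdiff.1 he).1).1⟩
  have hVne : ∀ e ∈ (G \ coloops M G) \ {w₀, x}, e ≠ k ∧ e ≠ w₀ ∧ e ≠ x := by
    intro e he
    refine ⟨(Finset.mem_erase.1 (hVk he)).1, ?_, ?_⟩
    · intro h'
      exact (Finset.mem_sdiff.1 he).2 (h' ▸ Finset.mem_insert_self _ _)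
    · intro h'
      exact (Finset.mem_sdiff.1 he).2 (h' ▸ Finset.mem_insert_of_mem (Finset.mem_singleton_self _))
  have hoffD : ∀ e, e ∈ ({w₀, x} : Finset α) → e ∈ G ∧ e ∉ clF M B₀ := by
    intro e he
    rw [← hD] at he
    exact Finset.mem_sdiff.1 he
  have hw₀D := hoffD w₀ (Finset.mem_insert_self _ _)
  have hxD := hoffD x (Finset.mem_insert_of_mem (Finset.mem_singleton_self _))
  have hxk : x ≠ k := fun h' => hxD.2 (h' ▸ subset_clF_of_subset_gr (hB₀G.trans hGg) (hKB₀ hkc))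
  have hR₁g : R₁ ⊆ gr M := hR₁V.trans hVg
  have hc₂g : c₂ ∈ gr M := hVg hc₂V
  have hc₃g : c₃ ∈ gr M := hVg hc₃V
  have hc₃R : c₃ ∉ clF M R₁ := fun h' => hc₃ (clF_mono (Finset.subset_insert _ _) h')
  have hc₂R : c₂ ∉ R₁ := fun h' => hc₂ (subset_clF_of_subset_gr hR₁g h')
  have hπ₂3 : rkN M (insert c₂ R₁) = 3 := by rw [rkN_insert_of_notMem_clF hc₂g hc₂, hR₁2]
  have hπ₃3 : rkN M (insert c₃ R₁) = 3 := by rw [rkN_insert_of_notMem_clF hc₃g hc₃R, hR₁2]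
  have hc₂' : c₂ ∉ clF M (insert c₃ R₁) := by
    intro h'
    have h1 : rkN M (insert c₂ (insert c₃ R₁)) ≤ 3 := by
      have := rkN_mono (M := M) (X := insert c₂ (insert c₃ R₁)) (Y := clF M (insert c₃ R₁))
        (Finset.insert_subset h' (subset_clF_of_subset_gr (Finset.insert_subset hc₃g hR₁g)))
      rw [rkN_clF, hπ₃3] at this
      exact this
    have h2 : rkN M (insert c₃ (insert c₂ R₁)) = 4 := by
      rw [rkN_insert_of_notMem_clF hc₃g hc₃, hπ₂3]
    rw [Finset.insert_comm] at h2
    omega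
  set V := (G \ coloops M G) \ {w₀, x} with hV
  set Mset := V.filter (fun e => e ∈ clF M (insert c₃ R₁) ∧ e ∉ clF M R₁) with hMset
  set Aset := V.filter (fun e => e ∈ clF M (insert c₂ R₁) ∧ e ∉ clF M R₁) with hAset
  have hM2 : 2 ≤ Mset.card :=
    two_le_card_side hG hd hk hs hB₀ hD hR₁V hR₁2 hR₁3 hcop hc₂V hc₃V hc₂ hc₃ hcover
  have hA2 : 2 ≤ Aset.card := two_le_card_side hG hd hk hs hB₀ hD hR₁V hR₁2 hR₁3 hcop hc₃V hc₂V hc₃R hc₂'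
    (fun e he => (hcover e he).symm)
  have hc₃M : c₃ ∈ Mset :=
    Finset.mem_filter.2 ⟨hc₃V, subset_clF_of_subset_gr (Finset.insert_subset hc₃g hR₁g)
      (Finset.mem_insert_self _ _), hc₃R⟩
  have hc₂A : c₂ ∈ Aset :=
    Finset.mem_filter.2 ⟨hc₂V, subset_clF_of_subset_gr (Finset.insert_subset hc₂g hR₁g)
      (Finset.mem_insert_self _ _), hc₂⟩
  by_contra hlt
  have hM2' : Mset.card = 2 := by omega
  -- the second point `m` of `π₃` off the spine and a second point `a'` of `π₂` off the spine
  obtain ⟨m, hmM, hmc₃⟩ := Finset.exists_mem_ne (by omega : 1 < Mset.card) c₃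
  obtain ⟨a', ha'A, ha'c₂⟩ := Finset.exists_mem_ne (by omega : 1 < Aset.card) c₂
  have hmV : m ∈ V := (Finset.mem_filter.1 hmM).1
  have hmπ₃ : m ∈ clF M (insert c₃ R₁) := (Finset.mem_filter.1 hmM).2.1
  have hmR₁ : m ∉ clF M R₁ := (Finset.mem_filter.1 hmM).2.2
  have ha'V : a' ∈ V := (Finset.mem_filter.1 ha'A).1
  have ha'π₂ : a' ∈ clF M (insert c₂ R₁) := (Finset.mem_filter.1 ha'A).2.1
  have ha'R₁ : a' ∉ clF M R₁ := (Finset.mem_filter.1 ha'A).2.2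
  have hmg : m ∈ gr M := hVg hmV
  have ha'g : a' ∈ gr M := hVg ha'V
  -- a spine point `s₃` off the line `c₃ m`
  obtain ⟨s₃, hs₃, hs₃cl⟩ : ∃ s₃ ∈ R₁, s₃ ∉ clF M {c₃, m} := by
    by_contra hall
    have hR₁cl : R₁ ⊆ clF M {c₃, m} := fun s' hs' => by_contra (fun h' => hall ⟨s', hs', h'⟩)
    have hrk2 : rkN M {c₃, m} = 2 := hs c₃ hc₃g m hmg hmc₃.symm
    have heq : clF M R₁ = clF M {c₃, m} :=
      clF_eq_clF_of_subset_clF_of_rkN_le (Finset.insert_subset hc₃g (Finset.singleton_subset_iff.2 hmg))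
        hR₁cl (by omega)
    exact hc₃R (heq ▸ subset_clF_of_subset_gr
      (Finset.insert_subset hc₃g (Finset.singleton_subset_iff.2 hmg)) (Finset.mem_insert_self _ _))
  obtain ⟨s₁, hs₁, s₂, hs₂, hs12⟩ := Finset.one_lt_card.1
    (by rw [Finset.card_erase_of_mem hs₃]; omega : 1 < (R₁.erase s₃).card)
  have hs₁R : s₁ ∈ R₁ := (Finset.mem_erase.1 hs₁).2
  have hs₂R : s₂ ∈ R₁ := (Finset.mem_erase.1 hs₂).2
  have hs₁3 : s₁ ≠ s₃ := (Finset.mem_erase.1 hs₁).1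
  have hs₂3 : s₂ ≠ s₃ := (Finset.mem_erase.1 hs₂).1
  set B' : Finset α := insert k (insert w₀ (insert s₁ (insert s₂ {c₂}))) with hB'
  have hside := sdiff_clF_eq_side hG hd hs hB₀ hD hR₁V hR₁2 hcop hc₂V hc₃V hc₂ hc₃ hcover hkK hs₁R hs₂R hs12
  have hB'5 := rkN_side_member_eq_five hG hd hs hB₀ hD hR₁V hR₁2 hc₂V hc₂ hkK hs₁R hs₂R hs12
  have hB'G : B' ⊆ G := by
    intro e he
    simp only [hB', Finset.mem_insert, Finset.mem_singleton] at he
    rcases he with rfl | rfl | rfl | rfl | rfl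
    · exact hkG
    · exact hw₀D.1
    · exact (Finset.mem_sdiff.1 (Finset.mem_sdiff.1 (hR₁V hs₁R)).1).1
    · exact (Finset.mem_sdiff.1 (Finset.mem_sdiff.1 (hR₁V hs₂R)).1).1
    · exact (Finset.mem_sdiff.1 (Finset.mem_sdiff.1 hc₂V).1).1
  have hKB' : coloops M G ⊆ B' := by
    rw [hkK]
    exact Finset.singleton_subset_iff.2 (Finset.mem_insert_self _ _)
  -- membership of a point of `V` off the spine and off `c₂` in the complement of `B'`
  have hnotB' : ∀ e ∈ V, e ∉ clF M R₁ → e ≠ c₂ → e ∉ B' := by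
    intro e he heR hec
    obtain ⟨hek, hew, -⟩ := hVne e he
    simp only [hB', Finset.mem_insert, Finset.mem_singleton, not_or]
    refine ⟨hek, hew, ?_, ?_, hec⟩
    · rintro rfl
      exact heR (subset_clF_of_subset_gr hR₁g hs₁R)
    · rintro rfl
      exact heR (subset_clF_of_subset_gr hR₁g hs₂R)
  have hc₃c₂ : c₃ ≠ c₂ := fun h' => hc₃ (h' ▸ subset_clF_of_subset_gr
    (Finset.insert_subset hc₂g hR₁g) (Finset.mem_insert_self _ _))
  have hmc₂ : m ≠ c₂ := by
    rintro rfl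
    exact hc₂' hmπ₃
  have hs₃B' : s₃ ∉ B' := by
    obtain ⟨hek, hew, -⟩ := hVne s₃ (hR₁V hs₃)
    simp only [hB', Finset.mem_insert, Finset.mem_singleton, not_or]
    exact ⟨hek, hew, fun h' => hs₁3 h'.symm, fun h' => hs₂3 h'.symm, fun h' => hc₂R (h' ▸ hs₃)⟩
  have hxB' : x ∉ B' := by
    simp only [hB', Finset.mem_insert, Finset.mem_singleton, not_or]
    refine ⟨hxk, hne.symm, ?_, ?_, ?_⟩
    · rintro rfl
      exact (hVne _ (hR₁V hs₁R)).2.2 rfl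
    · rintro rfl
      exact (hVne _ (hR₁V hs₂R)).2.2 rfl
    · rintro rfl
      exact (hVne _ hc₂V).2.2 rfl
  -- the five points `c₃, m, s₃, x, a'` of `G ∖ B'` have rank `5`
  have hr2 : rkN M {c₃, m} = 2 := hs c₃ hc₃g m hmg hmc₃.symm
  have hr3 : rkN M (insert s₃ {c₃, m}) = 3 := by
    rw [rkN_insert_of_notMem_clF (hR₁g hs₃) hs₃cl, hr2]
  have hT3g : insert s₃ {c₃, m} ⊆ gr M :=
    Finset.insert_subset (hR₁g hs₃) (Finset.insert_subset hc₃g (Finset.singleton_subset_iff.2 hmg))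
  have hT3B₀ : insert s₃ {c₃, m} ⊆ clF M B₀ :=
    Finset.insert_subset (hVB₀ (hR₁V hs₃)) (Finset.insert_subset (hVB₀ hc₃V)
      (Finset.singleton_subset_iff.2 (hVB₀ hmV)))
  have hxT3 : x ∉ clF M (insert s₃ {c₃, m}) := fun h' =>
    hxD.2 (clF_subset_clF_of_subset_clF hT3B₀ h')
  have hr4 : rkN M (insert x (insert s₃ {c₃, m})) = 4 := by
    rw [rkN_insert_of_notMem_clF (hGg hxD.1) hxT3, hr3]
  have hT4g : insert x (insert s₃ {c₃, m}) ⊆ gr M := Finset.insert_subset (hGg hxD.1) hT3g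
  -- `clF {s₃, c₃, m} = π₃`
  have hT3π₃ : clF M (insert s₃ {c₃, m}) = clF M (insert c₃ R₁) := by
    apply clF_eq_clF_of_subset_clF_of_rkN_le (Finset.insert_subset hc₃g hR₁g)
    · exact Finset.insert_subset (subset_clF_of_subset_gr (Finset.insert_subset hc₃g hR₁g)
        (Finset.mem_insert_of_mem hs₃)) (Finset.insert_subset (subset_clF_of_subset_gr
        (Finset.insert_subset hc₃g hR₁g) (Finset.mem_insert_self _ _))
        (Finset.singleton_subset_iff.2 hmπ₃))
    · omega
  have ha'T4 : a' ∉ clF M (insert x (insert s₃ {c₃, m})) := by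
    intro h'
    -- `clF T₄ ∩ clF B₀` has rank `≤ 3` and contains `{s₃, c₃, m}`: it is `π₃`
    have hint := rkN_inter_clF_add_le (M := M) hT4g (hB₀G.trans hGg)
    have hB₀5 : rkN M B₀ = 5 := rkN_eq_five_of_mem_thinMembers hB₀
    have hunion : 6 ≤ rkN M (insert x (insert s₃ {c₃, m}) ∪ B₀) := by
      have h1 : rkN M (insert x B₀) = 6 := by
        rw [rkN_insert_of_notMem_clF (hGg hxD.1) hxD.2, hB₀5]
      have h2 : insert x B₀ ⊆ insert x (insert s₃ {c₃, m}) ∪ B₀ :=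
        Finset.insert_subset (Finset.mem_union_left _ (Finset.mem_insert_self _ _))
          Finset.subset_union_right
      have := rkN_mono (M := M) h2
      omega
    have hint3 : rkN M (clF M (insert x (insert s₃ {c₃, m})) ∩ clF M B₀) ≤ 3 := by omega
    have hT3int : insert s₃ {c₃, m} ⊆ clF M (insert x (insert s₃ {c₃, m})) ∩ clF M B₀ := by
      intro e he
      exact Finset.mem_inter.2 ⟨subset_clF_of_subset_gr hT4g (Finset.mem_insert_of_mem he), hT3B₀ he⟩
    have hintg : clF M (insert x (insert s₃ {c₃, m})) ∩ clF M B₀ ⊆ gr M :=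
      Finset.inter_subset_left.trans (fun e' he' => mem_gr_of_mem_clF he')
    have hcl : clF M (insert s₃ {c₃, m}) =
        clF M (clF M (insert x (insert s₃ {c₃, m})) ∩ clF M B₀) :=
      clF_eq_clF_of_subset_clF_of_rkN_le hintg (hT3int.trans (subset_clF_of_subset_gr hintg)) (by omega)
    have ha'π₃ : a' ∈ clF M (insert c₃ R₁) := by
      rw [← hT3π₃, hcl]
      exact subset_clF_of_subset_gr hintg (Finset.mem_inter.2 ⟨h', hVB₀ ha'V⟩)
    exact ha'R₁ (mem_clF_of_mem_two_planes hR₁g hc₂g hc₃g hc₂ hc₃ ha'π₂ ha'π₃)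
  have hr5 : rkN M (insert a' (insert x (insert s₃ {c₃, m}))) = 5 := by
    rw [rkN_insert_of_notMem_clF ha'g ha'T4, hr4]
  have hsub5 : insert a' (insert x (insert s₃ {c₃, m})) ⊆ G \ B' := by
    intro e he
    simp only [Finset.mem_insert, Finset.mem_singleton] at he
    rw [Finset.mem_sdiff]
    rcases he with rfl | rfl | rfl | rfl | rfl
    · exact ⟨(Finset.mem_sdiff.1 (Finset.mem_sdiff.1 ha'V).1).1, hnotB' _ ha'V ha'R₁ ha'c₂⟩
    · exact ⟨hxD.1, hxB'⟩
    · exact ⟨(Finset.mem_sdiff.1 (Finset.mem_sdiff.1 (hR₁V hs₃)).1).1, hs₃B'⟩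
    · exact ⟨(Finset.mem_sdiff.1 (Finset.mem_sdiff.1 hc₃V).1).1, hnotB' _ hc₃V hc₃R hc₃c₂⟩
    · exact ⟨(Finset.mem_sdiff.1 (Finset.mem_sdiff.1 hmV).1).1, hnotB' _ hmV hmR₁ hmc₂⟩
  have hrk5 : rkN M (G.erase k) = 5 := by
    have h1 := rkN_insert_of_notMem_clF (hGg hkG) hkcl
    rw [Finset.insert_erase hkG, hG6] at h1
    omega
  have hc5 : rkN M (G \ B') = 5 := by
    apply le_antisymm
    · have : G \ B' ⊆ G.erase k := fun e he =>
        Finset.mem_erase.2 ⟨fun h' => (Finset.mem_sdiff.1 he).2 (h' ▸ hKB' hkc), (Finset.mem_sdiff.1 he).1⟩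
      exact hrk5 ▸ rkN_mono this
    · exact hr5 ▸ rkN_mono hsub5
  have hthin : B' ∈ thinMembers M 5 G :=
    mem_thinMembers_of_rkN_five hG hd hk hB₀ hB'G hKB' hB'5 hc5 (by rw [hside, ← hMset, hM2']; omega)
  -- two fat closures
  have hfat1 : clF M B' ∈ fatClosures M 5 G 2 := by
    unfold fatClosures
    exact Finset.mem_image_of_mem _ (Finset.mem_filter.2 ⟨hthin, by rw [hside, ← hMset, hM2']⟩)
  have hfat0 : clF M B₀ ∈ fatClosures M 5 G 2 := by
    unfold fatClosures
    exact Finset.mem_image_of_mem _ (Finset.mem_filter.2 ⟨hB₀, by rw [hD, Finset.card_pair hne]⟩)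
  have hne' : clF M B' ≠ clF M B₀ := by
    intro h'
    have : w₀ ∈ clF M B' := subset_clF_of_subset_gr (hB'G.trans hGg)
      (Finset.mem_insert_of_mem (Finset.mem_insert_self _ _))
    rw [h'] at this
    exact hw₀D.2 this
  have := Finset.card_le_card (Finset.insert_subset hfat1 (Finset.singleton_subset_iff.2 hfat0))
  rw [Finset.card_pair hne'] at this
  omega

end PercRepro.Shadow
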